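import Summits.QuantumFields.YangMills.Theorems.BalabanUVNodesN07H1ReadingTraceSectors
import HarnessLib

/-!
# NODE N07 — THE `𝔄`-ROW TRACE HALF OF def-Y's SCHEME OF RECORD: the log-coordinate `B(V)(c) = (1/i)·log(V(c)Ū(c)⋆)` of [15] (20) is TRACELESS
# (`tr log W = 0` for `W ∈ SU(N)` near `1`, lit ✓`ExpMeanLog.trace_mlog_eq_zero`), hence the shift `𝔄(V) = H₁B(V)` of (103) has TRACELESS jet at every bond
# — the trace companion of ✓`…N07FrakGOfRecordReality.equiv_frakAOfRecordAtBg128_star` ([15] (20) p. 281, (103) p. 293, (51) p. 286; [7] (21)–(23) p. 21)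

Cell `pub-ymgap`, width seat `pub-ymgap-dag-n07-w3` (g27), CLAIM-1.  `--kind proof --supports stmt-QuantumFields-27238 --as helper`; count-neutral.
[15] = [Balaban1985Variational]; [7] = [Balaban1985Averaging]; [B9] = [Balaban1985BackgroundPropagators].

WHY.  ✓`Node00.BgSchemeChartLie.lieTokAt_of_rows` reads the Lie token «`iX(b) ∈ 𝔰𝔲(N)`» of the [15] Prop. 6 chart from four ROWS over the real sectors
`TY := evHerm0` (jets Hermitian AND traceless on every bond), `TZ` (currents); the `𝔄`-row is «`𝔄(V) ∈ evHerm0`».  Its Hermitian half is ✓p822030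
(`equiv_frakAOfRecordAtBg128_star`); this file is the traceless half: `B(V)` is traceless because `V(c)Ū(c)⋆ ∈ SU(N)` and `tr log = log det = 0` on the
principal branch, and `H₁` maps traceless block fields to traceless jets (✓p824079 `trace_equiv_H1OfRecordAt_eq_zero`).
* §1 `mem_SU_V_mul_star_iter` (bookkeeping: `V(c)Ū(c)⋆ ∈ SU(N)`), ★`trace_BOfRecord_apply` (any `N`: `‖V(c)Ū(c)⋆ − 1‖ ≤ 1/4` and `N‖V(c)Ū(c)⋆ − 1‖ < π`),
  `trace_BOfRecord_apply_two` (`N = 2`: the `1/4`-smallness alone).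
* §2 ★★`trace_equiv_frakAOfRecordAtBg128_eq_zero` (any `N`, commuting data `G′`, `Δ⁽²⁾` and `Δ(U₀)` displayed), ★★`trace_equiv_frakAOfRecordAtBg128_eq_zero_two`
  (`N = 2`, commuting `G′`, `Δ⁽²⁾`; `Δ(U₀)` commutes by ✓`scalPartW_comp_hessOpOfRecord_two`), and the `ev`-presented forms `trace_evLit_frakAOfRecordAtBg128_eq_zero{_two}`
  (the letter `S.ev = η·evLit` of ✓`Node00.bgSchemeOfRecord`).

HONEST LABELS.  Linear∕`*`-algebra bookkeeping over cited tree facts; the guard, `hposπ`, `hQ`, the smallness of `V(c)Ū(c)⋆ − 1` and the data rows are displayed;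
no estimate of Bałaban.  With ✓p822030 this closes the `𝔄`-row INPUTS (Hermitian + traceless) at `N = 2`; the `W`-row trace half and the assembly of
`lieTokAt_of_rows` are NOT here.  Count-neutral; N07 NOT discharged; P0 ⟨26900⟩ OPEN; R4 is the conditional finite-𝕋⁴ rung only.  Nothing here is a claim
about the Yang–Mills mass gap (`Summit.QuantumFields`): finite torus, fixed `ε`; nothing continuum ∕ OS ∕ Clay.
-/

set_option autoImplicit false

noncomputable section

open scoped Matrix Matrix.Norms.L2Operator InnerProductSpace ComplexConjugate BigOperators

namespace Summit.QuantumFields.YangMills.Theorems.N07FrakAOfRecordTraceSectors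

open Literature.MathematicalPhysics.QuantumFieldTheory.Balaban1983to89
open Literature.MathematicalPhysics.QuantumFieldTheory.Balaban1983to89.T4Continuum (T4Family)
open T4Continuum BlockAveraging
open Node00
open B9SectCLatticeCarrier (Bond)
open B9Eq311L2Pairing (WL2)
open B11Eq103H1Complex (SiteL2K BondL2K)
open B11Eq115Space (NegSup NegSize levWeight JetSup)
open B11Eq111FrakG (nabla115)
open MatrixLog (mlog)
open Summit.QuantumFields.YangMills.Theorems.N07TraceSectorDefs (scalPartW)
open Summit.QuantumFields.YangMills.Theorems.N07TraceSectorProjection (scalPartW_comp_hessOpOfRecord_two)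
open Summit.QuantumFields.YangMills.Theorems.N07SlotCTraceSectors (scalPartW_hessOpOfRecord128)
open Summit.QuantumFields.YangMills.Theorems.N07H1ReadingTraceSectors (trace_equiv_H1OfRecordAt_eq_zero)

/-! ## §1  `B(V)` is traceless -/

section B

variable (F : T4Family) (N : ℕ) [NeZero N] {K : ℕ} (k : ℕ) (U₀ : GaugeField (F.P K) 0 (SU N))

/-- Bookkeeping: `V(c)·(Ū^kU₀)(c)⋆ ∈ SU(N)` (both factors in `SU(N)`, `⋆ = ⁻¹` there). [cite: Balaban1985Variational, (20) p.281 (bookkeeping)] -/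
theorem mem_SU_V_mul_star_iter (V : GaugeField (F.P K) k (SU N)) (c : PBond (F.P K) k) :
    (V c : Matrix (Fin N) (Fin N) ℂ) * star (Averaging.iter (avOfRecord F N K) k U₀ c : Matrix (Fin N) (Fin N) ℂ) ∈
      Matrix.specialUnitaryGroup (Fin N) ℂ := by
  have hm := (V c * (Averaging.iter (avOfRecord F N K) k U₀ c)⁻¹).2
  rwa [Submonoid.coe_mul, coe_inv_SU] at hm

/-- ★ **`B(V)(c) = (1/i)·log(V(c)Ū^kU₀(c)⋆)` IS TRACELESS** when the argument `W = V(c)Ū(c)⋆ ∈ SU(N)` of `log` satisfies `‖W − 1‖ ≤ 1/4` and `N‖W − 1‖ < π`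
(`e^{tr log W} = det W = 1` and `|tr log W| ≤ 2N‖W − 1‖ < 2π`; lit ✓`ExpMeanLog.trace_mlog_eq_zero`). [cite: Balaban1985Variational, (20) p.281, (51) p.286; Balaban1985Averaging, (21)–(23) p.21] -/
theorem trace_BOfRecord_apply (levB : PBond (F.P K) k → ℕ) (V : GaugeField (F.P K) k (SU N)) (c : PBond (F.P K) k)
    (hV : ‖(V c : Matrix (Fin N) (Fin N) ℂ) * star (Averaging.iter (avOfRecord F N K) k U₀ c : Matrix (Fin N) (Fin N) ℂ) - 1‖ ≤ 1 / 4)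
    (hVπ : (N : ℝ) * ‖(V c : Matrix (Fin N) (Fin N) ℂ) * star (Averaging.iter (avOfRecord F N K) k U₀ c : Matrix (Fin N) (Fin N) ℂ) - 1‖ < Real.pi) :
    (NegSup.equiv _ _ (BOfRecord F N K k U₀ levB V) c).trace = 0 := by
  have hπ : (Fintype.card (Fin N) : ℝ) *
      ‖(V c : Matrix (Fin N) (Fin N) ℂ) * star (Averaging.iter (avOfRecord F N K) k U₀ c : Matrix (Fin N) (Fin N) ℂ) - 1‖ < Real.pi := by
    rwa [Fintype.card_fin]
  rw [BOfRecord_apply, Matrix.trace_smul,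
    ExpMeanLog.trace_mlog_eq_zero (mem_SU_V_mul_star_iter F N k U₀ V c) (hV.trans (by norm_num)) hπ, smul_zero]

/-- **`B(V)` IS A TRACELESS BLOCK FIELD** under the bondwise smallness (any `N`). [cite: Balaban1985Variational, (20) p.281, (51) p.286] -/
theorem trace_BOfRecord (levB : PBond (F.P K) k → ℕ) (V : GaugeField (F.P K) k (SU N))
    (hV : ∀ c, ‖(V c : Matrix (Fin N) (Fin N) ℂ) * star (Averaging.iter (avOfRecord F N K) k U₀ c : Matrix (Fin N) (Fin N) ℂ) - 1‖ ≤ 1 / 4)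
    (hVπ : ∀ c, (N : ℝ) * ‖(V c : Matrix (Fin N) (Fin N) ℂ) * star (Averaging.iter (avOfRecord F N K) k U₀ c : Matrix (Fin N) (Fin N) ℂ) - 1‖ < Real.pi) :
    ∀ c, (NegSup.equiv _ _ (BOfRecord F N K k U₀ levB V) c).trace = 0 :=
  fun c => trace_BOfRecord_apply F N k U₀ levB V c (hV c) (hVπ c)

end B

section BTwo

variable (F : T4Family) {K : ℕ} (k : ℕ) (U₀ : GaugeField (F.P K) 0 (SU 2))

/-- **`N = 2`: `B(V)(c)` IS TRACELESS under the `1/4`-smallness alone** (`2·(1/4) < π`). [cite: Balaban1985Variational, (20) p.281, (51) p.286] -/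
theorem trace_BOfRecord_apply_two (levB : PBond (F.P K) k → ℕ) (V : GaugeField (F.P K) k (SU 2)) (c : PBond (F.P K) k)
    (hV : ‖(V c : Matrix (Fin 2) (Fin 2) ℂ) * star (Averaging.iter (avOfRecord F 2 K) k U₀ c : Matrix (Fin 2) (Fin 2) ℂ) - 1‖ ≤ 1 / 4) :
    (NegSup.equiv _ _ (BOfRecord F 2 K k U₀ levB V) c).trace = 0 := by
  refine trace_BOfRecord_apply F 2 k U₀ levB V c hV ?_
  have hπ : (3 : ℝ) < Real.pi := Real.pi_gt_three
  push_cast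
  linarith

end BTwo

/-! ## §2  `𝔄(V) = H₁B(V)` has traceless jet -/

section FrakA

variable (F : T4Family) (N : ℕ) [NeZero N] {K : ℕ} (k : ℕ) (U₀ : GaugeField (F.P K) 0 (SU N)) [Fact (0 < c0Rec F K k)] [Fact (∀ c, 0 < wBRec F K k c)]
  [Fact (0 < (F.L : ℝ))] [Fact (0 < (F.P K).eta k)] (Ω : ℕ → Set (Site (F.P K) 0))
  {Gp : SiteL2K ℂ (F.P K).d (fun _ => (F.P K).sitesPerDir 0) (c0Rec F K k) (WRec N) →ₗ[ℂ]
    SiteL2K ℂ (F.P K).d (fun _ => (F.P K).sitesPerDir 0) (c0Rec F K k) (WRec N)}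
  {Δ2 : BondL2K ℂ (F.P K).d (fun _ => (F.P K).sitesPerDir 0) (c0Rec F K k) (WRec N) →ₗ[ℂ]
    BondL2K ℂ (F.P K).d (fun _ => (F.P K).sitesPerDir 0) (c0Rec F K k) (WRec N)} {a : ℝ}
  (hposπ : ∀ x, x ≠ 0 → 0 < RCLike.re ⟪x, laplaceAOfRecordAt F N k U₀ (hessOpOfRecord128 F N k U₀ Gp (QflatOfRecord F N k) Δ2)
    (QOfRecord F N k U₀) (QflatOfRecord F N k) a x⟫_ℂ)

set_option maxRecDepth 16384 in
set_option maxHeartbeats 800000 in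
/-- ★★ **THE SHIFT `𝔄(V) = H₁B(V)` OF SLOT (c) HAS TRACELESS JET AT EVERY BOND** — any `N`, for data `G′`, `Δ⁽²⁾` and the bare Hessian `Δ(U₀)` commuting with the scalar part
(displayed; `Δ(U₀)` commutes at `N = 2`), under 35b's guard, when every `V(c)Ū(c)⋆` satisfies `‖· − 1‖ ≤ 1/4`, `N‖· − 1‖ < π`.
[cite: Balaban1985Variational, (103) p.293, (20) p.281, (51) p.286; Balaban1985BackgroundPropagators, (3.128)–(3.129) p.421] -/
theorem trace_equiv_frakAOfRecordAtBg128_eq_zero (levB : PBond (F.P K) k → ℕ) (h : SmallBelow (avOfRecord F N K) k U₀)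
    (hGp : ∀ s, Gp (scalPartW N _ s) = scalPartW N _ (Gp s)) (hΔ : ∀ x, hessOpOfRecord F N k U₀ (scalPartW N _ x) = scalPartW N _ (hessOpOfRecord F N k U₀ x))
    (hΔ2 : ∀ x, Δ2 (scalPartW N _ x) = scalPartW N _ (Δ2 x)) (hQ : Function.Surjective (QOfRecord F N k U₀)) (V : GaugeField (F.P K) k (SU N))
    (hV : ∀ c, ‖(V c : Matrix (Fin N) (Fin N) ℂ) * star (Averaging.iter (avOfRecord F N K) k U₀ c : Matrix (Fin N) (Fin N) ℂ) - 1‖ ≤ 1 / 4)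
    (hVπ : ∀ c, (N : ℝ) * ‖(V c : Matrix (Fin N) (Fin N) ℂ) * star (Averaging.iter (avOfRecord F N K) k U₀ c : Matrix (Fin N) (Fin N) ℂ) - 1‖ < Real.pi)
    (b : Bond (F.P K).d (fun _ => (F.P K).sitesPerDir 0)) :
    (JetSup.equiv _ _ (nabla115 ((F.P K).eta k) (unitsOfRecord F N U₀)) (frakAOfRecordAtBg128 F N K k Ω U₀ levB Gp Δ2 a hposπ hQ V) b).trace = 0 := by
  rw [frakAOfRecordAtBg128_eq]
  exact trace_equiv_H1OfRecordAt_eq_zero F N k U₀ Ω (Δ₁ := hessOpOfRecord128 F N k U₀ Gp (QflatOfRecord F N k) Δ2) hposπ levB h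
    (scalPartW_hessOpOfRecord128 F N k U₀ hGp hΔ hΔ2) hQ (trace_BOfRecord F N k U₀ levB V hV hVπ) b

set_option maxRecDepth 16384 in
set_option maxHeartbeats 800000 in
/-- **The same, read through the presentation `ev = evLit` of ✓`Node00.bgSchemeOfRecord`** (`ev A c = A(bondToLit c)`): `𝔄(V)` is traceless on every record bond.
[cite: Balaban1985Variational, (19) p.281, (103) p.293, (51) p.286] -/
theorem trace_evLit_frakAOfRecordAtBg128_eq_zero (levB : PBond (F.P K) k → ℕ) (h : SmallBelow (avOfRecord F N K) k U₀)
    (hGp : ∀ s, Gp (scalPartW N _ s) = scalPartW N _ (Gp s)) (hΔ : ∀ x, hessOpOfRecord F N k U₀ (scalPartW N _ x) = scalPartW N _ (hessOpOfRecord F N k U₀ x))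
    (hΔ2 : ∀ x, Δ2 (scalPartW N _ x) = scalPartW N _ (Δ2 x)) (hQ : Function.Surjective (QOfRecord F N k U₀)) (V : GaugeField (F.P K) k (SU N))
    (hV : ∀ c, ‖(V c : Matrix (Fin N) (Fin N) ℂ) * star (Averaging.iter (avOfRecord F N K) k U₀ c : Matrix (Fin N) (Fin N) ℂ) - 1‖ ≤ 1 / 4)
    (hVπ : ∀ c, (N : ℝ) * ‖(V c : Matrix (Fin N) (Fin N) ℂ) * star (Averaging.iter (avOfRecord F N K) k U₀ c : Matrix (Fin N) (Fin N) ℂ) - 1‖ < Real.pi)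
    (c : PBond (F.P K) 0) :
    (evLit F N K k Ω U₀ (frakAOfRecordAtBg128 F N K k Ω U₀ levB Gp Δ2 a hposπ hQ V) c).trace = 0 := by
  rw [evLit_apply]
  exact trace_equiv_frakAOfRecordAtBg128_eq_zero F N k U₀ Ω hposπ levB h hGp hΔ hΔ2 hQ V hV hVπ _

end FrakA

section FrakATwo

variable (F : T4Family) {K : ℕ} (k : ℕ) (U₀ : GaugeField (F.P K) 0 (SU 2)) [Fact (0 < c0Rec F K k)] [Fact (∀ c, 0 < wBRec F K k c)]
  [Fact (0 < (F.L : ℝ))] [Fact (0 < (F.P K).eta k)] (Ω : ℕ → Set (Site (F.P K) 0))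
  {Gp : SiteL2K ℂ (F.P K).d (fun _ => (F.P K).sitesPerDir 0) (c0Rec F K k) (WRec 2) →ₗ[ℂ]
    SiteL2K ℂ (F.P K).d (fun _ => (F.P K).sitesPerDir 0) (c0Rec F K k) (WRec 2)}
  {Δ2 : BondL2K ℂ (F.P K).d (fun _ => (F.P K).sitesPerDir 0) (c0Rec F K k) (WRec 2) →ₗ[ℂ]
    BondL2K ℂ (F.P K).d (fun _ => (F.P K).sitesPerDir 0) (c0Rec F K k) (WRec 2)} {a : ℝ}
  (hposπ : ∀ x, x ≠ 0 → 0 < RCLike.re ⟪x, laplaceAOfRecordAt F 2 k U₀ (hessOpOfRecord128 F 2 k U₀ Gp (QflatOfRecord F 2 k) Δ2)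
    (QOfRecord F 2 k U₀) (QflatOfRecord F 2 k) a x⟫_ℂ)

set_option maxRecDepth 16384 in
set_option maxHeartbeats 800000 in
/-- ★★ **`N = 2`: THE SHIFT `𝔄(V) = H₁B(V)` HAS TRACELESS JET AT EVERY BOND** for commuting data `G′`, `Δ⁽²⁾`, under 35b's guard, when every `V(c)Ū(c)⋆` is within `1/4` of `1`
— with ✓`equiv_frakAOfRecordAtBg128_star` the two halves of the `𝔄`-ROW «`𝔄(V) ∈ evHerm0`» of ✓`Node00.BgSchemeChartLie.lieTokAt_of_rows` at the scheme of record.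
[cite: Balaban1985Variational, (103) p.293, (20) p.281, (51) p.286, Prop. 6 p.295; Balaban1985BackgroundPropagators, (3.128) p.421] -/
theorem trace_equiv_frakAOfRecordAtBg128_eq_zero_two (levB : PBond (F.P K) k → ℕ) (h : SmallBelow (avOfRecord F 2 K) k U₀)
    (hGp : ∀ s, Gp (scalPartW 2 _ s) = scalPartW 2 _ (Gp s)) (hΔ2 : ∀ x, Δ2 (scalPartW 2 _ x) = scalPartW 2 _ (Δ2 x))
    (hQ : Function.Surjective (QOfRecord F 2 k U₀)) (V : GaugeField (F.P K) k (SU 2))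
    (hV : ∀ c, ‖(V c : Matrix (Fin 2) (Fin 2) ℂ) * star (Averaging.iter (avOfRecord F 2 K) k U₀ c : Matrix (Fin 2) (Fin 2) ℂ) - 1‖ ≤ 1 / 4)
    (b : Bond (F.P K).d (fun _ => (F.P K).sitesPerDir 0)) :
    (JetSup.equiv _ _ (nabla115 ((F.P K).eta k) (unitsOfRecord F 2 U₀)) (frakAOfRecordAtBg128 F 2 K k Ω U₀ levB Gp Δ2 a hposπ hQ V) b).trace = 0 := by
  have hΔ : ∀ y : BondL2K ℂ (F.P K).d (fun _ => (F.P K).sitesPerDir 0) (c0Rec F K k) (WRec 2),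
      hessOpOfRecord F 2 k U₀ (scalPartW 2 _ y) = scalPartW 2 _ (hessOpOfRecord F 2 k U₀ y) := fun y => by
    rw [← LinearMap.comp_apply, ← scalPartW_comp_hessOpOfRecord_two F K k U₀, LinearMap.comp_apply]
  have hVπ : ∀ c, ((2 : ℕ) : ℝ) * ‖(V c : Matrix (Fin 2) (Fin 2) ℂ) * star (Averaging.iter (avOfRecord F 2 K) k U₀ c : Matrix (Fin 2) (Fin 2) ℂ) - 1‖ < Real.pi :=
    fun c => by
      have hπ : (3 : ℝ) < Real.pi := Real.pi_gt_three
      have := hV c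
      push_cast
      linarith
  exact trace_equiv_frakAOfRecordAtBg128_eq_zero F 2 k U₀ Ω hposπ levB h hGp hΔ hΔ2 hQ V hV hVπ b

set_option maxRecDepth 16384 in
set_option maxHeartbeats 800000 in
/-- **`N = 2`, `ev`-presented form**: `ev(𝔄(V))(c)` is traceless on every record bond (`ev = evLit`, the letter `S.ev = η·evLit` of the scheme of record).
[cite: Balaban1985Variational, (19) p.281, (103) p.293, (51) p.286] -/
theorem trace_evLit_frakAOfRecordAtBg128_eq_zero_two (levB : PBond (F.P K) k → ℕ) (h : SmallBelow (avOfRecord F 2 K) k U₀)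
    (hGp : ∀ s, Gp (scalPartW 2 _ s) = scalPartW 2 _ (Gp s)) (hΔ2 : ∀ x, Δ2 (scalPartW 2 _ x) = scalPartW 2 _ (Δ2 x))
    (hQ : Function.Surjective (QOfRecord F 2 k U₀)) (V : GaugeField (F.P K) k (SU 2))
    (hV : ∀ c, ‖(V c : Matrix (Fin 2) (Fin 2) ℂ) * star (Averaging.iter (avOfRecord F 2 K) k U₀ c : Matrix (Fin 2) (Fin 2) ℂ) - 1‖ ≤ 1 / 4)
    (c : PBond (F.P K) 0) :
    (evLit F 2 K k Ω U₀ (frakAOfRecordAtBg128 F 2 K k Ω U₀ levB Gp Δ2 a hposπ hQ V) c).trace = 0 := by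
  rw [evLit_apply]
  exact trace_equiv_frakAOfRecordAtBg128_eq_zero_two F k U₀ Ω hposπ levB h hGp hΔ2 hQ V hV _

end FrakATwo

end Summit.QuantumFields.YangMills.Theorems.N07FrakAOfRecordTraceSectors

end
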